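/-
Copyright (c) 2026 the pub-hodgecm-mathlib formalisation cell (harness21).  Prover seat hodgecm-mathlib-K2E3-p14 (g6), Track B «K2-LIT» ∕ h413
(`stmt-HodgeConjecture-24833`), line `K2_E3_EllipticInputs`, road (11-3-split-nsc), leaf (nsc-S-A′) «principal-block standard span», brick E2-I (part 1):
INDUCTION IN STAGES FOR `B ≤ P₍₂,₁₎ ≤ GL₃(F)` — THE `GL₃`-MAP `Ind_{P₂₁}(I(x,y) ⊠ z) → I(x,y,z)` AND ITS INJECTIVITY.  2026-09-04.
-/
import Literature.NumberTheory.Automorphic.SmoothInduction                              -- ★ `smoothIndRep`, Frobenius reciprocity `frobeniusInv`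
import Literature.NumberTheory.Automorphic.ParabolicInduction                            -- ★ `parabolicIndGL`, instance `LocallyCompactSpace P_c`
import Literature.NumberTheory.Automorphic.ParabolicGLBigCell                            -- ★ `borel_le_standardParabolicGL`
import Literature.NumberTheory.Automorphic.GLReindex                                     -- ★ `reindexGL`
import Literature.NumberTheory.Automorphic.GLnMaximalParabolicLocalModulus               -- ★ `rootDeltaChar_standardParabolicGL_bool`
import Literature.NumberTheory.Automorphic.PrincipalSeriesGL2SatakeParameters            -- ★ `coe_rootDeltaChar_standardParabolicGL_fin_two`
import Summits.HodgeConjecture.HodgeConjecture.Theorems.K2E3GL3BorelModulus               -- ★ `rootDeltaChar_borel_three`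
import HarnessLib

/-!
# K2_E3 road (h413), (11-3-split-nsc) leaf (nsc-S-A′), brick E2-I (part 1) — induction in stages `B ≤ P₍₂,₁₎ ≤ GL₃(F)`: the map
# `Ind_{P₂₁}(I(x,y) ⊠ z) → I(x,y,z)` and its injectivity

Cell `pub/hodgecm-mathlib` (D-0151), Track B, seat K2E3-p14 (g6); leaf architecture K2E3-p25 (g0) `MEMO-SA-architecture.v1` brick E2, CONVENTIONS of the leaf
owner's HEADS line (K2 bus 2026-09-04 08:40:11Z): `LB N := Π a : Fin N, GL {i : Fin N // id i = a} F`, `crd a := det ∘ eval a`, `tch θ := ∏ a, (θ a) ∘ crd a`,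
`I θ := parabolicIndGL F id (𝟙 ⊗ tch θ)`, `box σ ψ := (σ ∘ (reindexGL e)⁻¹ ∘ eval false) ⊗ (ψ ∘ det ∘ eval true)` on the Levi of `P₂₁ = standardParabolicGL F ![false,false,true]`
(all spelled INLINE below — no definitions).  `--supports stmt-HodgeConjecture-24833 --as helper`; THEOREMS ONLY; never imports `Cruxes/…/Lines`.  COUNT-NEUTRAL.

THE MATHEMATICS ([BernsteinZelevinsky1977, Prop. 1.9 (c), §2.3: `i_{G,M} ∘ i_{M,L} = i_{G,L}`]; [Casselman1995, Prop. 3.2.?]; [Bump1997, §4.5]).  `G = GL₃(F)`, `B` the Borel,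
`Q = P₂₁ ⊇ B` with Levi `GL₂ × GL₁`, `I₂ = I(x,y) = Ind_{B₂}^{GL₂}(x ⊗ y ⊗ δ_{B₂}^{1∕2})`, `ρ_Q = (I₂ ⊠ z) ⊗ δ_Q^{1∕2}` inflated to `Q`.  The `B`-map
`Φ₀ : Ind_Q^G ρ_Q |_B → ℂ_{χ₃}`, `F ↦ (F(1))(1)` is `B`-equivariant for `χ₃ = (x ⊗ y ⊗ z) ⊗ δ_B^{1∕2}` PRECISELY BECAUSE `δ_B^{1∕2}(b) = δ_Q^{1∕2}(b) · δ_{B₂}^{1∕2}(b|_{GL₂})`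
(★ `rootDeltaChar_borel_three` ∕ ★ `rootDeltaChar_standardParabolicGL_bool` ∕ ★ `coe_rootDeltaChar_standardParabolicGL_fin_two`: `‖a‖‖c‖⁻¹ = (‖ab‖‖c‖⁻²)^{1∕2} (‖a‖‖b‖⁻¹)^{1∕2}`);
Frobenius reciprocity (★ `frobeniusInv`) turns it into the `G`-map `Φ : Ind_Q(I₂ ⊠ z) → I(x,y,z)`, `(Φ F)(g) = (F(g))(1)`, and `Φ` is INJECTIVE:
`(F(g))(g₂) = δ_Q^{-1∕2}(ι g₂) · (F(ι(g₂) g))(1)` for the block embedding `ι : GL₂ → Q`.  (Surjectivity — the inverse `f ↦ (g ↦ (g₂ ↦ δ_Q^{-1∕2}(ι g₂) f(ι(g₂) g)))` — is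
part 2.)

* §1 block bookkeeping on `B ≤ Q`: `det_leviProjection_id_eq_entry`, `det_leviProjection_twoOne_true`, `reindex_block_apply`, `reindex_block_mem_borel_two`,
  `det_reindex_block_eq`;
* §2 **`rootDeltaChar_borel_three_eq_mul`** — `δ_B^{1∕2}(b) = δ_{P₂₁}^{1∕2}(b) · δ_{B₂}^{1∕2}(b|_{GL₂})`;
* §3 **`exists_injective_intertwiningMap_parabolicIndGL_twoOne_box`** — `∃ Φ : Ind_{P₂₁}(box (I ![x,y]) z) → I ![x,y,z]`, `G`-intertwining, INJECTIVE, with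
  `(Φ F).toFun g = ((F.toFun g).toFun 1)`.

HONEST LABEL: HC_CM is proved only modulo the 7 printed citations (2 remaining named inputs: hLiu418 = stmt-HodgeConjecture-24832, h413 =
stmt-HodgeConjecture-24833) until rung 0 closes; count-neutral helper.

## References
* [BernsteinZelevinsky1977] I. N. Bernstein, A. V. Zelevinsky, *Induced representations of reductive 𝔭-adic groups I*, Ann. Sci. ÉNS 10 (1977): Prop. 1.9, §2.3.
* [Bump1997] D. Bump, *Automorphic Forms and Representations* (1997): §4.5 (Frobenius reciprocity, induction in stages).
* [Casselman1995] W. Casselman, *Introduction to the theory of admissible representations of p-adic reductive groups* (notes, 1995): §3.2.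
-/

set_option autoImplicit false
set_option linter.dupNamespace false

noncomputable section

open scoped MatrixGroups NNReal

namespace Summit.HodgeConjecture.HodgeConjecture.Cruxes.H413.K2E3GL3InductionInStagesEmbedding

open Literature.NumberTheory.Automorphic
open Literature.NumberTheory.GaloisRepresentations Literature.NumberTheory.GaloisRepresentations.IsNonarchimedeanLocalField

/-! ## §1 Block bookkeeping on `B ≤ P₂₁ ≤ GL₃` -/

section Blocks

variable {R : Type*} [CommRing R] {N : ℕ}

/-- The `a`-th diagonal block of `b ∈ B` (Borel labelling `id`) has determinant the entry `b a a`. [cite: BernsteinZelevinsky1977, §2.1] -/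
theorem det_leviProjection_id_eq_entry (b : ↥(standardParabolicGL R (id : Fin N → Fin N))) (a : Fin N) :
    ((Matrix.GeneralLinearGroup.det (leviProjection R (id : Fin N → Fin N) b a) : Rˣ) : R) =
      ((b : GL (Fin N) R) : Matrix (Fin N) (Fin N) R) a a := by
  haveI := K2E3GLnPrincipalBlockEmbedding.subsingleton_fiber_id (N := N) a
  rw [Matrix.GeneralLinearGroup.val_det_apply, Matrix.det_eq_elem_of_subsingleton _ ⟨a, rfl⟩, leviProjection_apply_coe]

/-- The `true`-block of the labelling `![false, false, true]` of `Fin 3` is the single index `2`. [folklore] -/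
theorem subsingleton_block_true : Subsingleton {i : Fin 3 // (![false, false, true] : Fin 3 → Bool) i = true} := by
  refine ⟨fun i j => Subtype.ext ?_⟩
  have hi := i.2
  have hj := j.2
  revert hi hj
  rcases i with ⟨i, _⟩
  rcases j with ⟨j, _⟩
  fin_cases i <;> fin_cases j <;> simp

/-- The `GL₁`-block of `q ∈ P₂₁ ≤ GL₃` has determinant `q 2 2`. [cite: BernsteinZelevinsky1977, §2.1] -/
theorem det_leviProjection_twoOne_true (q : ↥(standardParabolicGL R (![false, false, true] : Fin 3 → Bool))) :
    ((Matrix.GeneralLinearGroup.det (leviProjection R (![false, false, true] : Fin 3 → Bool) q true) : Rˣ) : R) =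
      ((q : GL (Fin 3) R) : Matrix (Fin 3) (Fin 3) R) 2 2 := by
  haveI := subsingleton_block_true
  rw [Matrix.GeneralLinearGroup.val_det_apply,
    Matrix.det_eq_elem_of_subsingleton _ (⟨2, rfl⟩ : {i : Fin 3 // (![false, false, true] : Fin 3 → Bool) i = true}),
    leviProjection_apply_coe]

end Blocks

section Reindex

variable {R : Type*} [Field R]
  (e : Fin 2 ≃ {i : Fin 3 // (![false, false, true] : Fin 3 → Bool) i = false})
  (he : ∀ j : Fin 2, ((e j : {i : Fin 3 // (![false, false, true] : Fin 3 → Bool) i = false}) : Fin 3) = Fin.castSucc j)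

include he in
/-- Entries of the `GL₂`-block of `q ∈ P₂₁`, reindexed to `Fin 2` along `e`: `(block q) i j = q i j` (`i, j < 2`). [folklore] -/
theorem reindex_block_apply (q : ↥(standardParabolicGL R (![false, false, true] : Fin 3 → Bool))) (i j : Fin 2) :
    (((reindexGL e).symm (leviProjection R (![false, false, true] : Fin 3 → Bool) q false) : GL (Fin 2) R) :
        Matrix (Fin 2) (Fin 2) R) i j =
      ((q : GL (Fin 3) R) : Matrix (Fin 3) (Fin 3) R) (Fin.castSucc i) (Fin.castSucc j) := by
  rw [reindexGL_symm, coe_reindexGL, Matrix.reindex_apply, Matrix.submatrix_apply, Equiv.symm_symm, leviProjection_apply_coe, he, he]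

end Reindex


/-! ## §2 `δ_B^{1∕2} = δ_{P₂₁}^{1∕2} · δ_{B₂}^{1∕2}` on the Borel of `GL₃(F)` -/

section Delta

variable {F : Type*} [Field F] [ValuativeRel F] [TopologicalSpace F] [IsNonarchimedeanLocalField F]
  (e : Fin 2 ≃ {i : Fin 3 // (![false, false, true] : Fin 3 → Bool) i = false})
  (he : ∀ j : Fin 2, ((e j : {i : Fin 3 // (![false, false, true] : Fin 3 → Bool) i = false}) : Fin 3) = Fin.castSucc j)

/-- The labelling `![false, false, true]` of `Fin 3` is monotone (so `B ≤ P₂₁`, ★ `borel_le_standardParabolicGL`). [folklore] -/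
theorem monotone_twoOne : Monotone (![false, false, true] : Fin 3 → Bool) := by decide

omit [ValuativeRel F] [TopologicalSpace F] [IsNonarchimedeanLocalField F] in
include he in
/-- For `b` in the Borel of `GL₃`, its `GL₂`-block (reindexed to `Fin 2`) lies in the Borel of `GL₂`. [cite: BernsteinZelevinsky1977, §2.1] -/
theorem reindex_block_mem_borel_two (b : ↥(standardParabolicGL F (id : Fin 3 → Fin 3))) :
    (reindexGL e).symm (leviProjection F (![false, false, true] : Fin 3 → Bool)
        ⟨(b : GL (Fin 3) F), borel_le_standardParabolicGL monotone_twoOne b.2⟩ false) ∈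
      standardParabolicGL F (id : Fin 2 → Fin 2) := by
  rw [mem_standardParabolicGL_iff]
  intro i j hij
  rw [reindex_block_apply e he]
  exact blockTriangular_of_mem b (show (id (Fin.castSucc j) : Fin 3) < id (Fin.castSucc i) from Fin.castSucc_lt_castSucc_iff.2 hij)

omit [ValuativeRel F] [TopologicalSpace F] [IsNonarchimedeanLocalField F] in
include he in
/-- The `GL₂`-block of `b ∈ B ≤ GL₃` has determinant `b₀₀ b₁₁`. [cite: BernsteinZelevinsky1977, §2.1] -/
theorem det_block_false_eq (b : ↥(standardParabolicGL F (id : Fin 3 → Fin 3))) :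
    ((Matrix.GeneralLinearGroup.det (leviProjection F (![false, false, true] : Fin 3 → Bool)
        ⟨(b : GL (Fin 3) F), borel_le_standardParabolicGL monotone_twoOne b.2⟩ false) : Fˣ) : F) =
      ((b : GL (Fin 3) F) : Matrix (Fin 3) (Fin 3) F) 0 0 * ((b : GL (Fin 3) F) : Matrix (Fin 3) (Fin 3) F) 1 1 := by
  have h10 : ((b : GL (Fin 3) F) : Matrix (Fin 3) (Fin 3) F) 1 0 = 0 :=
    blockTriangular_of_mem b (show (id (0 : Fin 3)) < id (1 : Fin 3) by decide)
  have hdet : (((reindexGL e).symm (leviProjection F (![false, false, true] : Fin 3 → Bool)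
        ⟨(b : GL (Fin 3) F), borel_le_standardParabolicGL monotone_twoOne b.2⟩ false) : GL (Fin 2) F) : Matrix (Fin 2) (Fin 2) F).det =
      ((leviProjection F (![false, false, true] : Fin 3 → Bool)
        ⟨(b : GL (Fin 3) F), borel_le_standardParabolicGL monotone_twoOne b.2⟩ false :
          GL {i : Fin 3 // (![false, false, true] : Fin 3 → Bool) i = false} F) :
        Matrix {i : Fin 3 // (![false, false, true] : Fin 3 → Bool) i = false} {i : Fin 3 // (![false, false, true] : Fin 3 → Bool) i = false} F).det := by
    rw [reindexGL_symm, coe_reindexGL, Matrix.det_reindex_self]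
  rw [Matrix.GeneralLinearGroup.val_det_apply, ← hdet, Matrix.det_fin_two, reindex_block_apply e he, reindex_block_apply e he,
    reindex_block_apply e he, reindex_block_apply e he]
  simp [h10]

include he in
/-- **`δ_B^{1∕2}(b) = δ_{P₂₁}^{1∕2}(b) · δ_{B₂}^{1∕2}(b|_{GL₂})` on the Borel of `GL₃(F)`** — the normalising characters of `B ≤ GL₃`, of `P₂₁ ≤ GL₃` and of `B₂ ≤ GL₂`
(at the `GL₂`-block of `b`) are compatible: `‖a‖‖c‖⁻¹ = (‖ab‖‖c‖⁻²)^{1∕2} · (‖a‖‖b‖⁻¹)^{1∕2}` (★ `rootDeltaChar_borel_three`, ★ `rootDeltaChar_standardParabolicGL_bool`,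
★ `coe_rootDeltaChar_standardParabolicGL_fin_two`).  This is what makes normalised induction transitive. [cite: BernsteinZelevinsky1977, 1.7 and §2.3]
[cite: Bump1997, §4.5] -/
theorem rootDeltaChar_borel_three_eq_mul (b : ↥(standardParabolicGL F (id : Fin 3 → Fin 3))) :
    ((rootDeltaChar (standardParabolicGL F (id : Fin 3 → Fin 3)) b : ℂˣ) : ℂ) =
      ((rootDeltaChar (standardParabolicGL F (![false, false, true] : Fin 3 → Bool))
          ⟨(b : GL (Fin 3) F), borel_le_standardParabolicGL monotone_twoOne b.2⟩ : ℂˣ) : ℂ) *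
        ((rootDeltaChar (standardParabolicGL F (id : Fin 2 → Fin 2))
          ⟨(reindexGL e).symm (leviProjection F (![false, false, true] : Fin 3 → Bool)
              ⟨(b : GL (Fin 3) F), borel_le_standardParabolicGL monotone_twoOne b.2⟩ false),
            reindex_block_mem_borel_two e he b⟩ : ℂˣ) : ℂ) := by
  have h0 := K2E3GL3BorelModulus.diag_ne_zero_of_mem_borel b 0
  have h1 := K2E3GL3BorelModulus.diag_ne_zero_of_mem_borel b 1
  have h2 := K2E3GL3BorelModulus.diag_ne_zero_of_mem_borel b 2
  have hcard1 : Fintype.card {i : Fin 3 // (![false, false, true] : Fin 3 → Bool) i = true} = 1 := by decide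
  have hcard2 : Fintype.card {i : Fin 3 // (![false, false, true] : Fin 3 → Bool) i = false} = 2 := by decide
  rw [K2E3GL3BorelModulus.rootDeltaChar_borel_three, rootDeltaChar_standardParabolicGL_bool, coe_rootDeltaChar_standardParabolicGL_fin_two,
    hcard1, hcard2, det_block_false_eq e he, det_leviProjection_twoOne_true]
  dsimp only
  rw [reindex_block_apply e he, reindex_block_apply e he]
  simp only [Fin.castSucc_zero, Fin.castSucc_one, pow_one]
  rw [← Complex.ofReal_mul, ← NNReal.coe_mul, ← NNReal.sqrt_mul]
  congr 2
  symm
  rw [NNReal.sqrt_eq_iff_eq_sq, map_mul, map_div₀]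
  have ha : normAbs F (((b : GL (Fin 3) F) : Matrix (Fin 3) (Fin 3) F) 0 0) ≠ 0 := fun h => h0 ((map_eq_zero (normAbs F)).1 h)
  have hb : normAbs F (((b : GL (Fin 3) F) : Matrix (Fin 3) (Fin 3) F) 1 1) ≠ 0 := fun h => h1 ((map_eq_zero (normAbs F)).1 h)
  have hc : normAbs F (((b : GL (Fin 3) F) : Matrix (Fin 3) (Fin 3) F) 2 2) ≠ 0 := fun h => h2 ((map_eq_zero (normAbs F)).1 h)
  field_simp

end Delta

/-! ## §3 The `GL₃`-map `Φ : Ind_{P₂₁}(I(x,y) ⊠ z) → I(x,y,z)` and its injectivity -/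

section Main

variable {F : Type*} [Field F] [ValuativeRel F] [TopologicalSpace F] [IsNonarchimedeanLocalField F]
  (e : Fin 2 ≃ {i : Fin 3 // (![false, false, true] : Fin 3 → Bool) i = false})
  (he : ∀ j : Fin 2, ((e j : {i : Fin 3 // (![false, false, true] : Fin 3 → Bool) i = false}) : Fin 3) = Fin.castSucc j)

include he in
/-- **The inducing characters agree on `B`**: for `b ∈ B ≤ GL₃`,
`δ_Q^{1∕2}(b) · z(b₂₂) · δ_{B₂}^{1∕2}(b|_{GL₂}) · (x ⊗ y)(b|_{GL₂}) = δ_B^{1∕2}(b) · (x ⊗ y ⊗ z)(b)` — i.e. the restriction to `B` of the inducing datum of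
`Ind_{P₂₁}((Ind_{B₂} x ⊗ y) ⊠ z)` evaluated at `1 ∈ GL₂` is the inducing character of `I(x,y,z)` (§2 + block bookkeeping §1). [cite: BernsteinZelevinsky1977, Prop. 1.9, §2.3] -/
theorem inducing_scalar_borel_eq (x y z : Fˣ →* ℂˣ) (b : ↥(standardParabolicGL F (id : Fin 3 → Fin 3))) (c : ℂ) :
    ((rootDeltaChar (standardParabolicGL F (![false, false, true] : Fin 3 → Bool))
          ⟨(b : GL (Fin 3) F), borel_le_standardParabolicGL monotone_twoOne b.2⟩ : ℂˣ) : ℂ) *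
      (((((z.comp Matrix.GeneralLinearGroup.det).comp
          (Pi.evalMonoidHom (fun a : Bool => GL {i : Fin 3 // (![false, false, true] : Fin 3 → Bool) i = a} F) true))
          (leviProjection F (![false, false, true] : Fin 3 → Bool) ⟨(b : GL (Fin 3) F), borel_le_standardParabolicGL monotone_twoOne b.2⟩) : ℂˣ) : ℂ) *
      (((rootDeltaChar (standardParabolicGL F (id : Fin 2 → Fin 2))
          ⟨(reindexGL e).symm (leviProjection F (![false, false, true] : Fin 3 → Bool)
              ⟨(b : GL (Fin 3) F), borel_le_standardParabolicGL monotone_twoOne b.2⟩ false),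
            reindex_block_mem_borel_two e he b⟩ : ℂˣ) : ℂ) *
      ((((∏ a : Fin 2, ((![x, y] : Fin 2 → (Fˣ →* ℂˣ)) a).comp
          (Matrix.GeneralLinearGroup.det.comp (Pi.evalMonoidHom (fun a : Fin 2 => GL {i : Fin 2 // (id : Fin 2 → Fin 2) i = a} F) a)))
          (leviProjection F (id : Fin 2 → Fin 2)
            ⟨(reindexGL e).symm (leviProjection F (![false, false, true] : Fin 3 → Bool)
              ⟨(b : GL (Fin 3) F), borel_le_standardParabolicGL monotone_twoOne b.2⟩ false),
            reindex_block_mem_borel_two e he b⟩) : ℂˣ) : ℂ) * c))) =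
    ((rootDeltaChar (standardParabolicGL F (id : Fin 3 → Fin 3)) b : ℂˣ) : ℂ) *
      ((((∏ a : Fin 3, ((![x, y, z] : Fin 3 → (Fˣ →* ℂˣ)) a).comp
          (Matrix.GeneralLinearGroup.det.comp (Pi.evalMonoidHom (fun a : Fin 3 => GL {i : Fin 3 // (id : Fin 3 → Fin 3) i = a} F) a)))
          (leviProjection F (id : Fin 3 → Fin 3) b) : ℂˣ) : ℂ) * c) := by
  -- the three units `det` of the `1 × 1` blocks
  have hu0 : Matrix.GeneralLinearGroup.det (leviProjection F (id : Fin 2 → Fin 2)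
      ⟨(reindexGL e).symm (leviProjection F (![false, false, true] : Fin 3 → Bool)
        ⟨(b : GL (Fin 3) F), borel_le_standardParabolicGL monotone_twoOne b.2⟩ false), reindex_block_mem_borel_two e he b⟩ 0) =
      Matrix.GeneralLinearGroup.det (leviProjection F (id : Fin 3 → Fin 3) b 0) := by
    refine Units.ext ?_
    rw [det_leviProjection_id_eq_entry, det_leviProjection_id_eq_entry]
    dsimp only
    rw [reindex_block_apply e he]
    rfl
  have hu1 : Matrix.GeneralLinearGroup.det (leviProjection F (id : Fin 2 → Fin 2)
      ⟨(reindexGL e).symm (leviProjection F (![false, false, true] : Fin 3 → Bool)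
        ⟨(b : GL (Fin 3) F), borel_le_standardParabolicGL monotone_twoOne b.2⟩ false), reindex_block_mem_borel_two e he b⟩ 1) =
      Matrix.GeneralLinearGroup.det (leviProjection F (id : Fin 3 → Fin 3) b 1) := by
    refine Units.ext ?_
    rw [det_leviProjection_id_eq_entry, det_leviProjection_id_eq_entry]
    dsimp only
    rw [reindex_block_apply e he]
    rfl
  have hu2 : Matrix.GeneralLinearGroup.det (leviProjection F (![false, false, true] : Fin 3 → Bool)
      ⟨(b : GL (Fin 3) F), borel_le_standardParabolicGL monotone_twoOne b.2⟩ true) =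
      Matrix.GeneralLinearGroup.det (leviProjection F (id : Fin 3 → Fin 3) b 2) := by
    refine Units.ext ?_
    rw [det_leviProjection_twoOne_true, det_leviProjection_id_eq_entry]
  rw [rootDeltaChar_borel_three_eq_mul e he b]
  simp only [Fin.prod_univ_two, Fin.prod_univ_three, Matrix.cons_val_zero, Matrix.cons_val_one, Matrix.cons_val_two,
    Matrix.head_cons, Matrix.tail_cons, MonoidHom.mul_apply, MonoidHom.coe_comp, Function.comp_apply, Pi.evalMonoidHom_apply]
  rw [hu0, hu1, hu2]
  push_cast
  ring

/-- Evaluation of an induced function at an element of the inducing subgroup: `f(m) = σ(m) f(1)` for `m ∈ H`. [folklore] -/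
theorem toFun_eq_apply_toFun_one {k G W : Type*} [CommRing k] [Group G] [TopologicalSpace G] [SeparatelyContinuousMul G]
    [AddCommGroup W] [Module k W] {H : Subgroup G} {σ : Representation k H W} (f : Representation.SmoothInd H σ) {m : G} (hm : m ∈ H) :
    f.toFun m = σ ⟨m, hm⟩ (f.toFun 1) := by
  have h := f.toFun_subgroup_mul ⟨m, hm⟩ 1
  rwa [mul_one] at h

/-- Pointwise formula for normalised parabolic induction on `GL_n(F)`: `(i_c σ (g) f)(x) = f (x g)` (right translation). [folklore] -/
theorem toFun_parabolicIndGL_apply {n : Type*} [Fintype n] [DecidableEq n] {α : Type*} [LinearOrder α] [Fintype α] (c : n → α)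
    {W : Type*} [AddCommGroup W] [Module ℂ W] (σ : Representation ℂ (Π a, GL {i // c i = a} F) W) (g x : GL n F)
    (f : Representation.SmoothInd (standardParabolicGL F c)
      (Representation.twist (σ.comp (leviProjection F c)) (rootDeltaChar (standardParabolicGL F c)))) :
    (Representation.parabolicIndGL F c σ g f).toFun x = f.toFun (x * g) := rfl

include he in
set_option maxHeartbeats 400000 in
/-- **BRICK E2-I (part 1) — INDUCTION IN STAGES, THE EMBEDDING.**  For characters `x, y, z` of `F^×` and a block reindexing `e : Fin 2 ≃ {0,1} ⊂ Fin 3` there is an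
INJECTIVE `GL₃(F)`-intertwining map
`Φ : parabolicIndGL F ![false,false,true] (box (I ![x,y]) z) → I ![x,y,z]`, `(Φ F)(g) = (F(g))(1)`,
from normalised parabolic induction along `P₂₁` of `(Ind_{B₂}^{GL₂}(x ⊗ y ⊗ δ_{B₂}^{1∕2})) ⊠ z` to the principal series of `(x, y, z)` (all in the leaf owner's inline
vocabulary: `I θ = parabolicIndGL F id (𝟙 ⊗ ∏ (θ a ∘ det ∘ eval a))`, `box σ ψ = (σ ∘ (reindexGL e)⁻¹ ∘ eval false) ⊗ (ψ ∘ det ∘ eval true)`).  Frobenius reciprocity (★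
`frobeniusInv`) applied to the `B`-map `F ↦ (F(1))(1)`, `B`-equivariant by `inducing_scalar_borel_eq`; injective because `(F(g))(g₂) = δ_{P₂₁}^{-1∕2}(ι g₂) (F(ι(g₂) g))(1)`
for the block embedding `ι g₂ = leviEmbeddingP (mulSingle false (reindexGL e g₂))`. [cite: BernsteinZelevinsky1977, Prop. 1.9 (b)(c), §2.3] [cite: Bump1997, §4.5] -/
theorem exists_injective_intertwiningMap_parabolicIndGL_twoOne_box (x y z : Fˣ →* ℂˣ) :
    ∃ Φ : (Representation.parabolicIndGL F (![false, false, true] : Fin 3 → Bool)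
        (Representation.twist
          (((Representation.parabolicIndGL F (id : Fin 2 → Fin 2)
              ((Representation.trivial ℂ (Π a : Fin 2, GL {i : Fin 2 // (id : Fin 2 → Fin 2) i = a} F) ℂ).twist
                (∏ a : Fin 2, ((![x, y] : Fin 2 → (Fˣ →* ℂˣ)) a).comp
                  (Matrix.GeneralLinearGroup.det.comp
                    (Pi.evalMonoidHom (fun a : Fin 2 => GL {i : Fin 2 // (id : Fin 2 → Fin 2) i = a} F) a))))).comp
            (reindexGL e).symm.toMonoidHom).comp
            (Pi.evalMonoidHom (fun a : Bool => GL {i : Fin 3 // (![false, false, true] : Fin 3 → Bool) i = a} F) false))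
          ((z.comp Matrix.GeneralLinearGroup.det).comp
            (Pi.evalMonoidHom (fun a : Bool => GL {i : Fin 3 // (![false, false, true] : Fin 3 → Bool) i = a} F) true)))).IntertwiningMap
      (Representation.parabolicIndGL F (id : Fin 3 → Fin 3)
        ((Representation.trivial ℂ (Π a : Fin 3, GL {i : Fin 3 // (id : Fin 3 → Fin 3) i = a} F) ℂ).twist
          (∏ a : Fin 3, ((![x, y, z] : Fin 3 → (Fˣ →* ℂˣ)) a).comp
            (Matrix.GeneralLinearGroup.det.comp (Pi.evalMonoidHom (fun a : Fin 3 => GL {i : Fin 3 // (id : Fin 3 → Fin 3) i = a} F) a))))),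
      Function.Injective Φ ∧ ∀ F' g, (Φ F').toFun g = (F'.toFun g).toFun 1 := by
  classical
  have hBQ : ∀ b : ↥(standardParabolicGL F (id : Fin 3 → Fin 3)),
      (b : GL (Fin 3) F) ∈ standardParabolicGL F (![false, false, true] : Fin 3 → Bool) :=
    fun b => borel_le_standardParabolicGL monotone_twoOne b.2
  -- the `B`-map `Φ₀ : F ↦ (F 1)(1)` from `Ind_Q(box) |_B` to the inducing character `χ₃` of `I(x,y,z)`
  let Φ₀ : Representation.IntertwiningMap
      ((Representation.parabolicIndGL F (![false, false, true] : Fin 3 → Bool) (Representation.twist (((Representation.parabolicIndGL F (id : Fin 2 → Fin 2) ((Representation.trivial ℂ (Π a : Fin 2, GL {i : Fin 2 // (id : Fin 2 → Fin 2) i = a} F) ℂ).twist (∏ a : Fin 2, ((![x, y] : Fin 2 → (Fˣ →* ℂˣ)) a).comp (Matrix.GeneralLinearGroup.det.comp (Pi.evalMonoidHom (fun a : Fin 2 => GL {i : Fin 2 // (id : Fin 2 → Fin 2) i = a} F) a))))).comp (reindexGL e).symm.toMonoidHom).comp (Pi.evalMonoidHom (fun a : Bool => GL {i : Fin 3 //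 (![false, false, true] : Fin 3 → Bool) i = a} F) false)) ((z.comp Matrix.GeneralLinearGroup.det).comp (Pi.evalMonoidHom (fun a : Bool => GL {i : Fin 3 // (![false, false, true] : Fin 3 → Bool) i = a} F) true)))).comp (standardParabolicGL F (id : Fin 3 → Fin 3)).subtype)
      (Representation.twist (((Representation.trivial ℂ (Π a : Fin 3, GL {i : Fin 3 // (id : Fin 3 → Fin 3) i = a} F) ℂ).twist (∏ a : Fin 3, ((![x, y, z] : Fin 3 → (Fˣ →* ℂˣ)) a).comp (Matrix.GeneralLinearGroup.det.comp (Pi.evalMonoidHom (fun a : Fin 3 => GL {i : Fin 3 // (id : Fin 3 → Fin 3) i = a} F) a)))).comp (leviProjection F (id : Fin 3 → Fin 3))) (rootDeltaChar (standardParabolicGL F (id : Fin 3 → Fin 3)))) :=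
    { toFun := fun F' => (F'.toFun 1).toFun 1
      map_add' := fun F₁ F₂ => by
        simp only [Representation.SmoothInd.toFun_add, Pi.add_apply]
      map_smul' := fun c F' => by
        simp only [Representation.SmoothInd.toFun_smul, Pi.smul_apply, RingHom.id_apply]
      isIntertwining' := fun b => by
        refine LinearMap.ext fun F' => ?_
        simp only [LinearMap.coe_comp, Function.comp_apply, LinearMap.coe_mk, AddHom.coe_mk, MonoidHom.coe_comp, Subgroup.coe_subtype]
        rw [toFun_parabolicIndGL_apply, one_mul, toFun_eq_apply_toFun_one F' (hBQ b)]
        simp only [Representation.twist_apply, MonoidHom.coe_comp, Function.comp_apply, Pi.evalMonoidHom_apply, MulEquiv.coe_toMonoidHom,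
          Representation.SmoothInd.toFun_smul, Pi.smul_apply, Representation.trivial_apply]
        rw [toFun_parabolicIndGL_apply, one_mul, toFun_eq_apply_toFun_one (F'.toFun 1) (reindex_block_mem_borel_two e he b)]
        simp only [Representation.twist_apply, MonoidHom.coe_comp, Function.comp_apply, Representation.trivial_apply, smul_eq_mul]
        exact inducing_scalar_borel_eq e he x y z b _ }
  have hΦ₀ : ∀ v, Φ₀ v = (v.toFun 1).toFun 1 := fun _ => rfl
  clear_value Φ₀
  have hsm : Representation.IsSmooth (Representation.parabolicIndGL F (![false, false, true] : Fin 3 → Bool) (Representation.twist (((Representation.parabolicIndGL F (id : Fin 2 → Fin 2) ((Representation.trivial ℂ (Π a : Fin 2, GL {i : Fin 2 // (id : Fin 2 → Fin 2) i = a} F) ℂ).twist (∏ a : Fin 2, ((![x, y] : Fin 2 → (Fˣ →* ℂˣ)) a).comp (Matrix.GeneralLinearGroup.det.comp (Pi.evalMonoidHom (fun a : Fin 2 => GL {i : Fin 2 // (id : Fin 2 → Fin 2) i = a} F) a))))).comp (reindexGL e).symm.toMonoidHom).comp (Pi.evalMonoidHom (fun a : Bool => GL {i : Fin 3 // (![false,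 false, true] : Fin 3 → Bool) i = a} F) false)) ((z.comp Matrix.GeneralLinearGroup.det).comp (Pi.evalMonoidHom (fun a : Bool => GL {i : Fin 3 // (![false, false, true] : Fin 3 → Bool) i = a} F) true)))) := Representation.isSmooth_smoothInd _ _
  -- the formula `(Φ F)(g) = (F g)(1)` for `Φ = Frob(Φ₀)`
  have hform : ∀ (F' : Representation.SmoothInd (standardParabolicGL F (![false, false, true] : Fin 3 → Bool)) (Representation.twist ((Representation.twist (((Representation.parabolicIndGL F (id : Fin 2 → Fin 2) ((Representation.trivial ℂ (Π a : Fin 2, GL {i : Fin 2 // (id : Fin 2 → Fin 2) i = a} F) ℂ).twist (∏ a : Fin 2, ((![x, y] : Fin 2 → (Fˣ →* ℂˣ)) a).comp (Matrix.GeneralLinearGroup.det.comp (Pi.evalMonoidHom (fun a : Fin 2 => GL {i : Fin 2 // (id : Fin 2 → Fin 2) i = a} F) a))))).comp (reindexGL e).symm.toMonoidHom).comp (Pi.evalMonoidHom (fun a : Bool => GL {i : Fin 3 // (![false, false, true] : Fin 3 → Bool) i = a} F) false)) ((z.comp Matrix.GeneralLinearGroup.det).comp (Pi.evalMonoidHom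 (fun a : Bool => GL {i : Fin 3 // (![false, false, true] : Fin 3 → Bool) i = a} F) true))).comp (leviProjection F (![false, false, true] : Fin 3 → Bool))) (rootDeltaChar (standardParabolicGL F (![false, false, true] : Fin 3 → Bool))))) (g : GL (Fin 3) F),
      (Representation.frobeniusInv (H := standardParabolicGL F (id : Fin 3 → Fin 3)) hsm Φ₀ F').toFun g = (F'.toFun g).toFun 1 := by
    intro F' g
    rw [Representation.toFun_frobeniusInv_apply, hΦ₀, toFun_parabolicIndGL_apply, one_mul]
  -- `(F(ι(g₂) g))(1) = δ_Q^{1/2}(ι g₂) · (F(g))(g₂)` for the block embedding `ι g₂ = diag(g₂, 1)`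
  have key : ∀ (F' : Representation.SmoothInd (standardParabolicGL F (![false, false, true] : Fin 3 → Bool)) (Representation.twist ((Representation.twist (((Representation.parabolicIndGL F (id : Fin 2 → Fin 2) ((Representation.trivial ℂ (Π a : Fin 2, GL {i : Fin 2 // (id : Fin 2 → Fin 2) i = a} F) ℂ).twist (∏ a : Fin 2, ((![x, y] : Fin 2 → (Fˣ →* ℂˣ)) a).comp (Matrix.GeneralLinearGroup.det.comp (Pi.evalMonoidHom (fun a : Fin 2 => GL {i : Fin 2 // (id : Fin 2 → Fin 2) i = a} F) a))))).comp (reindexGL e).symm.toMonoidHom).comp (Pi.evalMonoidHom (fun a : Bool => GL {i : Fin 3 // (![false, false, true] : Fin 3 → Bool) i = a} F) false)) ((z.comp Matrix.GeneralLinearGroup.det).comp (Pi.evalMonoidHom (fun a : Bool => GL {i : Fin 3 // (![false, false, true] : Fin 3 → Bool) i = a} F) true))).comp (leviProjection F (![false, false, true] : Fin 3 → Bool))) (rootDeltaChar (standardParabolicGL F (![false, false, true] : Fin 3 → Bool))))) (g : GL (Fin 3) F) (g₂ : GL (Fin 2) F),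
      (F'.toFun ((((leviEmbeddingP F (![false, false, true] : Fin 3 → Bool) (Pi.mulSingle (M := (fun a : Bool => GL {i : Fin 3 // (![false, false, true] : Fin 3 → Bool) i = a} F)) false (reindexGL e g₂))) :
          ↥(standardParabolicGL F (![false, false, true] : Fin 3 → Bool))) : GL (Fin 3) F) * g)).toFun 1 =
        ((rootDeltaChar (standardParabolicGL F (![false, false, true] : Fin 3 → Bool))
            (leviEmbeddingP F (![false, false, true] : Fin 3 → Bool) (Pi.mulSingle (M := (fun a : Bool => GL {i : Fin 3 // (![false, false, true] : Fin 3 → Bool) i = a} F)) false (reindexGL e g₂))) : ℂˣ) : ℂ) •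
          (F'.toFun g).toFun g₂ := by
    intro F' g g₂
    rw [Representation.SmoothInd.toFun_subgroup_mul]
    simp only [Representation.twist_apply, MonoidHom.coe_comp, Function.comp_apply, Pi.evalMonoidHom_apply, MulEquiv.coe_toMonoidHom,
      Representation.SmoothInd.toFun_smul, Pi.smul_apply, leviProjection_leviEmbeddingP_apply, Pi.mulSingle_eq_same,
      Pi.mulSingle_eq_of_ne (show true ≠ false by decide), map_one, Units.val_one, one_smul, MulEquiv.symm_apply_apply,
      toFun_parabolicIndGL_apply, one_mul]
  refine ⟨Representation.frobeniusInv (H := standardParabolicGL F (id : Fin 3 → Fin 3)) hsm Φ₀, fun F₁ F₂ hF => ?_, hform⟩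
  refine Representation.SmoothInd.ext (funext fun g => Representation.SmoothInd.ext (funext fun g₂ => ?_))
  have h1 := hform F₁ ((((leviEmbeddingP F (![false, false, true] : Fin 3 → Bool) (Pi.mulSingle (M := (fun a : Bool => GL {i : Fin 3 // (![false, false, true] : Fin 3 → Bool) i = a} F)) false (reindexGL e g₂))) : ↥(standardParabolicGL F (![false, false, true] : Fin 3 → Bool))) : GL (Fin 3) F) * g)
  have h2 := hform F₂ ((((leviEmbeddingP F (![false, false, true] : Fin 3 → Bool) (Pi.mulSingle (M := (fun a : Bool => GL {i : Fin 3 // (![false, false, true] : Fin 3 → Bool) i = a} F)) false (reindexGL e g₂))) : ↥(standardParabolicGL F (![false, false, true] : Fin 3 → Bool))) : GL (Fin 3) F) * g)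
  have h3 : (Representation.frobeniusInv (H := standardParabolicGL F (id : Fin 3 → Fin 3)) hsm Φ₀ F₁).toFun ((((leviEmbeddingP F (![false, false, true] : Fin 3 → Bool) (Pi.mulSingle (M := (fun a : Bool => GL {i : Fin 3 // (![false, false, true] : Fin 3 → Bool) i = a} F)) false (reindexGL e g₂))) : ↥(standardParabolicGL F (![false, false, true] : Fin 3 → Bool))) : GL (Fin 3) F) * g) =
      (Representation.frobeniusInv (H := standardParabolicGL F (id : Fin 3 → Fin 3)) hsm Φ₀ F₂).toFun ((((leviEmbeddingP F (![false, false, true] : Fin 3 → Bool) (Pi.mulSingle (M := (fun a : Bool => GL {i : Fin 3 // (![false, false, true] : Fin 3 → Bool) i = a} F)) false (reindexGL e g₂))) : ↥(standardParabolicGL F (![false, false, true] : Fin 3 → Bool))) : GL (Fin 3) F) * g) :=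
    congrArg (fun f : Representation.SmoothInd (standardParabolicGL F (id : Fin 3 → Fin 3)) (Representation.twist (((Representation.trivial ℂ (Π a : Fin 3, GL {i : Fin 3 // (id : Fin 3 → Fin 3) i = a} F) ℂ).twist (∏ a : Fin 3, ((![x, y, z] : Fin 3 → (Fˣ →* ℂˣ)) a).comp (Matrix.GeneralLinearGroup.det.comp (Pi.evalMonoidHom (fun a : Fin 3 => GL {i : Fin 3 // (id : Fin 3 → Fin 3) i = a} F) a)))).comp (leviProjection F (id : Fin 3 → Fin 3))) (rootDeltaChar (standardParabolicGL F (id : Fin 3 → Fin 3)))) => f.toFun ((((leviEmbeddingP F (![false, false, true] : Fin 3 → Bool) (Pi.mulSingle (M := (fun a : Bool => GL {i : Fin 3 // (![false, false, true] : Fin 3 → Bool) i = a} F)) false (reindexGL e g₂))) : ↥(standardParabolicGL F (![false, false, true] : Fin 3 → Bool))) : GL (Fin 3) F) * g)) hF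
  have h4 := h1.symm.trans (h3.trans h2)
  rw [key, key, smul_eq_mul, smul_eq_mul] at h4
  exact mul_left_cancel₀ (Units.ne_zero _) h4

end Main




end Summit.HodgeConjecture.HodgeConjecture.Cruxes.H413.K2E3GL3InductionInStagesEmbedding

end
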